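import Mathlib.RingTheory.Flat.FaithfullyFlat.Basic
import Mathlib.LinearAlgebra.TensorProduct.Pi
import Mathlib.RingTheory.TensorProduct.Basic
import Mathlib.RingTheory.IsTensorProduct
import Mathlib.Algebra.DirectSum.Module
import Mathlib.Algebra.Algebra.Pi
import HarnessLib

/-!
# Finite products of algebras: flatness, faithful flatness, base change and the kernel-pair tensor product

Topic `Literature/RingTheory/Flat`, namespace `Literature.RingTheory.Flat`.  THEOREMS ONLY; no definition, no named
fact, no instance, no notation, no `sorry`.

For a commutative ring `R`, a FINITE index type `ι` and `R`-algebras `B i` (the affine pieces `Γ(U_i, 𝒪_Z)` of a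
quasi-compact open `g⁻¹V = ⋃ U_i` over an affine `V = Spec R` in the fpqc descent of sections, [StacksProject, Tag 023M]
reduction «we may assume the covering is given by a single faithfully flat ring map `R → ∏ B_i`»):

* §1 `flat_pi` — a finite product of flat modules is flat (Mathlib `Module.Flat.directSum` + `DirectSum.linearEquivFunOnFintype`);
  `smul_top_ne_top_of_comap_eq` — if a prime `𝔮 ⊂ S` lies over `𝔪 ⊂ R` then `𝔪S ≠ S`;
  **`faithfullyFlat_pi`** / **`faithfullyFlat_pi_of_liesOver`** — `∏ B_i` is faithfully flat over `R` as soon as every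
  `B_i` is flat and every maximal ideal of `R` fails to generate SOME `B_i` (e.g. has a prime of some `B_i` above it:
  «`Spec (∏ B_i) = ∐ Spec B_i → Spec R` surjective»). [StacksProject, Tag 00HQ]
* §2 **`isBaseChange_pi_algebra`** — base change along the product algebra: if `jᵢ : N → Pᵢ` is a base change of the
  `R`-module `N` to `B_i` for every `i`, then `n ↦ (jᵢ n)ᵢ : N → ∏ Pᵢ` is a base change of `N` to `∏ B_i`
  (`(∏ B_i) ⊗_R N = ∏ (B_i ⊗_R N)`, Mathlib `TensorProduct.piRight`). [StacksProject, Tag 023M]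
* §3 **`bijective_lift_pi_pi`** — the kernel pair of `R → ∏ B_i`: if for all `i, j` the maps `φ₁ : B_i → C_ij`,
  `φ₂ : B_j → C_ij` present `C_ij = B_i ⊗_R B_j`, then `ψ₁ b := (φ₁ bᵢ)_{ij}`, `ψ₂ b := (φ₂ bⱼ)_{ij}` present
  `∏_i ∏_j C_ij = (∏ B_i) ⊗_R (∏ B_j)` (the form ★ `RingTheory/Flat/AmitsurDescentData` consumes). [StacksProject, Tag 023M]

HC_CM is proved only modulo the 7 printed citations until rung 0 closes; nothing here is about HC.

## References
* [StacksProject] The Stacks Project, Tag 00HQ (Algebra, Lemma 10.39.16: faithfully flat ring maps), Tag 023M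
  (Descent, Lemma 35.3.6).
* [GortzWedhorn2020] U. Görtz, T. Wedhorn, *Algebraic Geometry I*, 2nd ed. (2020), Thm. 14.68, Prop. 14.66.
-/

open TensorProduct

namespace Literature.RingTheory.Flat

variable {R : Type*} [CommRing R] {ι : Type*} [Finite ι]

/-! ### §1 Flatness and faithful flatness of a finite product -/

section Flat

/-- **A finite product of flat modules is flat** (it is the finite direct sum; Mathlib `Module.Flat.directSum`,
`DirectSum.linearEquivFunOnFintype`). [cite: StacksProject, Tag 00HQ] -/
theorem flat_pi (M : ι → Type*) [∀ i, AddCommGroup (M i)] [∀ i, Module R (M i)] [∀ i, Module.Flat R (M i)] :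
    Module.Flat R (Π i, M i) := by
  classical
  cases nonempty_fintype ι
  exact Module.Flat.of_linearEquiv (DirectSum.linearEquivFunOnFintype R ι M).symm

/-- If a prime `𝔮` of the `R`-algebra `S` lies over the ideal `𝔪` of `R`, then `𝔪 • S ≠ S` (`𝔪S ⊆ 𝔮`).
[cite: StacksProject, Tag 00HQ] -/
theorem smul_top_ne_top_of_comap_eq {S : Type*} [CommRing S] [Algebra R S] (m : Ideal R) (q : Ideal S)
    [hq : q.IsPrime] (h : q.comap (algebraMap R S) = m) : m • (⊤ : Submodule R S) ≠ ⊤ := by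
  rw [Ideal.smul_top_eq_map]
  intro htop
  have hmap : m.map (algebraMap R S) = ⊤ := by
    rw [Submodule.restrictScalars_eq_top_iff] at htop
    exact htop
  have hle : m.map (algebraMap R S) ≤ q := Ideal.map_le_iff_le_comap.mpr h.ge
  exact hq.ne_top (top_le_iff.mp (hmap ▸ hle))

/-- **Faithful flatness of a finite product of modules**: if every `M_i` is flat and every maximal ideal `𝔪 ⊂ R`
has `𝔪 • M_i ≠ M_i` for SOME `i`, then `∏ M_i` is faithfully flat (project `𝔪 • ∏ M_i = ∏ M_i` to the `i`-th
factor). [cite: StacksProject, Tag 00HQ] [cite: GortzWedhorn2020, Thm. 14.68] -/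
theorem faithfullyFlat_pi (M : ι → Type*) [∀ i, AddCommGroup (M i)] [∀ i, Module R (M i)] [∀ i, Module.Flat R (M i)]
    (h : ∀ ⦃m : Ideal R⦄, m.IsMaximal → ∃ i, m • (⊤ : Submodule R (M i)) ≠ ⊤) :
    Module.FaithfullyFlat R (Π i, M i) := by
  classical
  haveI := flat_pi (R := R) M
  refine ⟨fun m hm heq => ?_⟩
  obtain ⟨i, hi⟩ := h hm
  apply hi
  have htop : Submodule.map (LinearMap.proj i : (Π i, M i) →ₗ[R] M i) ⊤ = ⊤ := by
    rw [Submodule.map_top, LinearMap.range_eq_top]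
    exact fun x => ⟨Pi.single i x, by simp⟩
  calc m • (⊤ : Submodule R (M i))
      = m • Submodule.map (LinearMap.proj i : (Π i, M i) →ₗ[R] M i) ⊤ := by rw [htop]
    _ = Submodule.map (LinearMap.proj i : (Π i, M i) →ₗ[R] M i) (m • ⊤) := (Submodule.map_smul'' _ _ _).symm
    _ = ⊤ := by rw [heq, htop]

/-- **Faithful flatness of `∏ B_i` from primes above**: if every `R`-algebra `B_i` is flat and every maximal ideal of `R`
is the contraction of a prime of SOME `B_i` (i.e. `∐ Spec B_i → Spec R` hits every closed point), then `∏ B_i` is a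
faithfully flat `R`-module. [cite: StacksProject, Tag 00HQ] [cite: GortzWedhorn2020, Thm. 14.68] -/
theorem faithfullyFlat_pi_of_liesOver (B : ι → Type*) [∀ i, CommRing (B i)] [∀ i, Algebra R (B i)]
    [∀ i, Module.Flat R (B i)]
    (h : ∀ ⦃m : Ideal R⦄, m.IsMaximal → ∃ (i : ι) (q : Ideal (B i)), q.IsPrime ∧ q.comap (algebraMap R (B i)) = m) :
    Module.FaithfullyFlat R (Π i, B i) :=
  faithfullyFlat_pi (R := R) B fun m hm => by
    obtain ⟨i, q, hq, hqm⟩ := h hm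
    exact ⟨i, smul_top_ne_top_of_comap_eq m q hqm⟩

end Flat

/-! ### §2 Base change along a finite product of algebras -/

section BaseChange

variable (B : ι → Type*) [∀ i, CommRing (B i)] [∀ i, Algebra R (B i)]
  {N : Type*} [AddCommGroup N] [Module R N]
  (P : ι → Type*) [∀ i, AddCommGroup (P i)] [∀ i, Module R (P i)] [∀ i, Module (B i) (P i)]
  [∀ i, IsScalarTower R (B i) (P i)]

/-- **Base change along the product algebra `R → ∏ B_i`**: if `jᵢ : N → Pᵢ` exhibits `Pᵢ` as `B_i ⊗_R N` for every
`i`, then `n ↦ (jᵢ n)ᵢ` exhibits `∏ Pᵢ` (a `∏ B_i`-module factorwise) as `(∏ B_i) ⊗_R N` — tensor products commute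
with finite products (Mathlib `TensorProduct.piRight`). [cite: StacksProject, Tag 023M] -/
theorem isBaseChange_pi_algebra (j : ∀ i, N →ₗ[R] P i) (hj : ∀ i, IsBaseChange (B i) (j i)) :
    IsBaseChange (Π i, B i) (LinearMap.pi j : N →ₗ[R] Π i, P i) := by
  classical
  cases nonempty_fintype ι
  -- the `R`-linear identification `(∏ B_i) ⊗ N ≅ ∏ (B_i ⊗ N) ≅ ∏ P_i`
  let E : (Π i, B i) ⊗[R] N ≃ₗ[R] (Π i, P i) :=
    TensorProduct.comm R (Π i, B i) N ≪≫ₗ TensorProduct.piRight R R N B ≪≫ₗ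
      LinearEquiv.piCongrRight fun i => TensorProduct.comm R N (B i) ≪≫ₗ ((hj i).equiv).restrictScalars R
  have hE : ∀ (b : Π i, B i) (n : N), E (b ⊗ₜ n) = fun i => b i • j i n := by
    intro b n
    ext i
    simp [E, IsBaseChange.equiv_tmul]
  -- it is `∏ B_i`-linear
  let e : (Π i, B i) ⊗[R] N ≃ₗ[Π i, B i] (Π i, P i) :=
    { E with
      map_smul' := fun c x => by
        change E (c • x) = c • E x
        induction x using TensorProduct.induction_on with
        | zero => simp
        | tmul b n =>
            rw [TensorProduct.smul_tmul', hE, smul_eq_mul, hE]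
            ext i
            simp [mul_smul]
        | add x y hx hy => simp only [smul_add, map_add, hx, hy] }
  refine IsBaseChange.of_equiv e fun n => ?_
  change E (1 ⊗ₜ n) = _
  rw [hE]
  ext i
  simp

end BaseChange

/-! ### §3 The kernel pair of `R → ∏ B_i` -/

section KernelPair

variable (B : ι → Type*) [∀ i, CommRing (B i)] [∀ i, Algebra R (B i)]
  (C : ι → ι → Type*) [∀ i j, CommRing (C i j)] [∀ i j, Algebra R (C i j)]
  (φ₁ : ∀ i j, B i →ₐ[R] C i j) (φ₂ : ∀ i j, B j →ₐ[R] C i j)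

/-- **`(∏ B_i) ⊗_R (∏ B_j) = ∏_i ∏_j (B_i ⊗_R B_j)` through the coprojections**: if `φ₁ : B_i → C_ij`,
`φ₂ : B_j → C_ij` present `C_ij` as `B_i ⊗_R B_j` for all `i, j` (`lift φ₁ φ₂` bijective), then
`ψ₁ b := (φ₁ bᵢ)_{ij}`, `ψ₂ b := (φ₂ bⱼ)_{ij} : ∏ B → ∏_i ∏_j C_ij` present the double product as
`(∏ B) ⊗_R (∏ B)` (`lift ψ₁ ψ₂` bijective) — the kernel pair of `Spec (∏ B_i) → Spec R` is the disjoint union of the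
`Spec (B_i ⊗ B_j)`. [cite: StacksProject, Tag 023M] -/
theorem bijective_lift_pi_pi
    (hφ : ∀ i j, Function.Bijective (Algebra.TensorProduct.lift (φ₁ i j) (φ₂ i j) fun _ _ => Commute.all _ _)) :
    Function.Bijective (Algebra.TensorProduct.lift
      (AlgHom.pi fun i => AlgHom.pi fun j => (φ₁ i j).comp (Pi.evalAlgHom R B i) :
        (Π i, B i) →ₐ[R] Π i, Π j, C i j)
      (AlgHom.pi fun i => AlgHom.pi fun j => (φ₂ i j).comp (Pi.evalAlgHom R B j) :
        (Π i, B i) →ₐ[R] Π i, Π j, C i j)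
      fun _ _ => Commute.all _ _) := by
  classical
  cases nonempty_fintype ι
  -- the `R`-linear identification `(∏ B) ⊗ (∏ B) ≅ ∏_i (B_i ⊗ ∏ B) ≅ ∏_i ∏_j (B_i ⊗ B_j) ≅ ∏_i ∏_j C_ij`
  let E : (Π i, B i) ⊗[R] (Π i, B i) ≃ₗ[R] (Π i, Π j, C i j) :=
    TensorProduct.comm R _ _ ≪≫ₗ TensorProduct.piRight R R _ B ≪≫ₗ
      LinearEquiv.piCongrRight fun i =>
        TensorProduct.comm R _ _ ≪≫ₗ TensorProduct.piRight R R (B i) B ≪≫ₗ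
          LinearEquiv.piCongrRight fun j =>
            LinearEquiv.ofBijective (Algebra.TensorProduct.lift (φ₁ i j) (φ₂ i j) fun _ _ => Commute.all _ _).toLinearMap
              (hφ i j)
  have hE : ∀ b b' : Π i, B i, E (b ⊗ₜ b') = fun i j => φ₁ i j (b i) * φ₂ i j (b' j) := by
    intro b b'
    ext i j
    simp [E, Algebra.TensorProduct.lift_tmul]
  have hlift : ∀ x, Algebra.TensorProduct.lift
      (AlgHom.pi fun i => AlgHom.pi fun j => (φ₁ i j).comp (Pi.evalAlgHom R B i) :
        (Π i, B i) →ₐ[R] Π i, Π j, C i j)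
      (AlgHom.pi fun i => AlgHom.pi fun j => (φ₂ i j).comp (Pi.evalAlgHom R B j) :
        (Π i, B i) →ₐ[R] Π i, Π j, C i j)
      (fun _ _ => Commute.all _ _) x = E x := by
    intro x
    induction x using TensorProduct.induction_on with
    | zero => simp
    | tmul b b' =>
        rw [Algebra.TensorProduct.lift_tmul, hE]
        ext i j
        simp [AlgHom.pi_apply]
    | add x y hx hy => rw [map_add, map_add, hx, hy]
  rw [show ⇑(Algebra.TensorProduct.lift _ _ _) = ⇑E from funext hlift]
  exact E.bijective

end KernelPair

end Literature.RingTheory.Flat
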